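import Mathlib.CategoryTheory.Galois.EssSurj
import Literature.AnabelianGeometry.Anabelioids.GaloisFullSubcategory
import Literature.AnabelianGeometry.Anabelioids.ProSigma
/-!
# The pro-`Σ` completion of a connected anabelioid is a connected anabelioid (proofs)

Proof-only companion of `Anabelioids/ProSigma.lean` ([SemiAnbd] Def. 2.9 (ii), p. 31): discharges
the named fact `proSigmaCompletion_galoisCategory`.

Strategy.  Let `A` be a Galois category with fibre functor `F` and fundamental group
`G = Aut F`.  For an object `X` write "`U` acts trivially on `X`" (`U ≤ G`) if every `σ ∈ U`
acts as the identity on the fibre `F(X)`.  The dictionary proved below is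

  `X` is dominated by a Galois object with `Σ`-automorphism group (`proSigmaObj Σ X`)
  `↔` some open normal subgroup `U ≤ G` of `Σ`-index acts trivially on `X`

(`exists_openNormal_of_proSigmaObj`, `proSigmaObj_of_openNormal`; the backward direction
realises `G ⧸ U` as the fibre of a Galois object via Mathlib's
`PreGaloisCategory.exists_lift_of_quotient_openSubgroup`).  In the second form the property is
visibly stable under terminal objects, pullbacks, finite coproducts, quotients by finite groups
and subobjects (intersect the subgroups; transfer triviality along jointly injective /
surjective maps of fibres), so `galoisCategory_fullSubcategory` applies.
-/

namespace Literature.AnabelianGeometry.Anabelioids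

open CategoryTheory CategoryTheory.Limits CategoryTheory.PreGaloisCategory

universe w v₁ u₁

/-! ### `Σ`-integers -/

/-- A divisor of a `Σ`-integer is a `Σ`-integer.
[cite: MochizukiSemiAnbd2006, Def. 2.9(i) p.31] -/
theorem IsSigmaInteger.of_dvd {Sigma : Set ℕ} {m n : ℕ} (hn : IsSigmaInteger Sigma n)
    (hmn : m ∣ n) : IsSigmaInteger Sigma m :=
  ⟨Nat.pos_of_dvd_of_pos hmn hn.1, fun p hp hpm => hn.2 p hp (hpm.trans hmn)⟩

/-- A product of `Σ`-integers is a `Σ`-integer. [cite: MochizukiSemiAnbd2006, Def. 2.9(i) p.31] -/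
theorem IsSigmaInteger.mul {Sigma : Set ℕ} {m n : ℕ} (hm : IsSigmaInteger Sigma m)
    (hn : IsSigmaInteger Sigma n) : IsSigmaInteger Sigma (m * n) :=
  ⟨Nat.mul_pos hm.1 hn.1, fun p hp hdvd =>
    ((Nat.Prime.dvd_mul hp).mp hdvd).elim (hm.2 p hp) (hn.2 p hp)⟩

/-- `1` is a `Σ`-integer. [cite: MochizukiSemiAnbd2006, Def. 2.9(i) p.31] -/
theorem IsSigmaInteger.one (Sigma : Set ℕ) : IsSigmaInteger Sigma 1 :=
  ⟨Nat.one_pos, fun _ hp h => absurd (Nat.eq_one_of_dvd_one h) hp.one_lt.ne'⟩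

/-- The index of the intersection of two finite-index subgroups, one of them normal, divides the
product of the indices; hence `Σ`-index subgroups are stable under binary intersection.
[cite: MochizukiSemiAnbd2006, Def. 2.9(i) p.31] -/
theorem IsSigmaInteger.index_inf {G : Type*} [Group G] {Sigma : Set ℕ} {U V : Subgroup G}
    [U.Normal] (hU : IsSigmaInteger Sigma U.index) (hV : IsSigmaInteger Sigma V.index) :
    IsSigmaInteger Sigma (U ⊓ V).index := by
  refine (hU.mul hV).of_dvd ?_
  rw [← Subgroup.relIndex_mul_index (inf_le_right : U ⊓ V ≤ V), Subgroup.inf_relIndex_right]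
  exact Nat.mul_dvd_mul_right (Subgroup.relIndex_dvd_index_of_normal (H := U) (K := V)) V.index

/-! ### Fibres of (co)limits and triviality of the action of an automorphism of `F` -/

section Fibres

variable {A : Type u₁} [Category.{v₁} A] [GaloisCategory A] (F : A ⥤ FintypeCat.{w})
  [FiberFunctor F]

/-- The fibre functor maps a finite limit cone to a jointly injective family (it preserves
finite limits, (G4)). [cite: SGA1, Exp. V §4 (condition (G4))] -/
theorem fiber_jointly_injective {J : Type} [SmallCategory J] [FinCategory J] {K : J ⥤ A}
    (c : Cone K) (hc : IsLimit c) (x y : F.obj c.pt)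
    (h : ∀ j, F.map (c.π.app j) x = F.map (c.π.app j) y) : x = y :=
  Concrete.isLimit_ext (K ⋙ F) (isLimitOfPreserves F hc) x y (fun j => by exact h j)

/-- The fibre functor maps a finite coproduct cocone to a jointly surjective family ((G5)).
[cite: SGA1, Exp. V §4 (condition (G5))] -/
theorem fiber_jointly_surjective {J : Type} [Finite J] {K : Discrete J ⥤ A}
    (c : Cocone K) (hc : IsColimit c) (x : F.obj c.pt) :
    ∃ (j : Discrete J) (y : F.obj (K.obj j)), F.map (c.ι.app j) y = x := by
  have := Fintype.ofFinite J
  obtain ⟨j, y, h⟩ :=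
    FintypeCat.jointly_surjective (K ⋙ F) (F.mapCocone c) (isColimitOfPreserves F hc) x
  exact ⟨j, y, h⟩

omit [GaloisCategory A] [FiberFunctor F] in
/-- In a quotient-by-a-group diagram (one object), the structure map to the colimit is an
epimorphism. [cite: SGA1, Exp. V §4 (condition (G2))] -/
theorem epi_ι_of_isColimit_singleObj {G : Type*} [Monoid G] {K : SingleObj G ⥤ A}
    (c : Cocone K) (hc : IsColimit c) : Epi (c.ι.app (SingleObj.star G)) :=
  ⟨fun _ _ e => hc.hom_ext fun j => by cases j; exact e⟩

omit [GaloisCategory A] [FiberFunctor F] in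
/-- If `σ ∈ Aut F` acts trivially on the fibre of `X` and `F(f) : F(X) → F(Y)` is surjective,
then `σ` acts trivially on the fibre of `Y`. [cite: SGA1, Exp. V §4] -/
theorem app_eq_id_of_surjective {X Y : A} (f : X ⟶ Y) (hf : Function.Surjective (F.map f))
    (σ : Aut F) (hX : σ.hom.app X = 𝟙 _) : σ.hom.app Y = 𝟙 _ := by
  ext y
  obtain ⟨x, rfl⟩ := hf y
  have := NatTrans.naturality_apply σ.hom f x
  rw [hX, FintypeCat.id_apply] at this
  simpa using this

omit [GaloisCategory A] [FiberFunctor F] in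
/-- If `σ ∈ Aut F` acts trivially on the fibre of `Y` and `F(i) : F(X) → F(Y)` is injective
(e.g. `i` mono), then `σ` acts trivially on the fibre of `X`. [cite: SGA1, Exp. V §4] -/
theorem app_eq_id_of_injective {X Y : A} (i : X ⟶ Y) (hi : Function.Injective (F.map i))
    (σ : Aut F) (hY : σ.hom.app Y = 𝟙 _) : σ.hom.app X = 𝟙 _ := by
  ext x
  apply hi
  have := NatTrans.naturality_apply σ.hom i x
  rw [hY, FintypeCat.id_apply] at this
  simpa using this.symm

/-- Triviality of the action of `σ ∈ Aut F` passes to finite limits. [cite: SGA1, Exp. V §4] -/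
theorem app_eq_id_of_isLimit {J : Type} [SmallCategory J] [FinCategory J] {K : J ⥤ A}
    (c : Cone K) (hc : IsLimit c) (σ : Aut F) (h : ∀ j, σ.hom.app (K.obj j) = 𝟙 _) :
    σ.hom.app c.pt = 𝟙 _ := by
  ext x
  refine fiber_jointly_injective F c hc _ _ fun j => ?_
  have := NatTrans.naturality_apply σ.hom (c.π.app j) x
  rw [h j, FintypeCat.id_apply] at this
  exact this.symm

/-- Triviality of the action of `σ ∈ Aut F` passes to finite coproducts.
[cite: SGA1, Exp. V §4] -/
theorem app_eq_id_of_isColimit {J : Type} [Finite J] {K : Discrete J ⥤ A}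
    (c : Cocone K) (hc : IsColimit c) (σ : Aut F) (h : ∀ j, σ.hom.app (K.obj j) = 𝟙 _) :
    σ.hom.app c.pt = 𝟙 _ := by
  ext x
  obtain ⟨j, y, rfl⟩ := fiber_jointly_surjective F c hc x
  have := NatTrans.naturality_apply σ.hom (c.ι.app j) y
  rw [h j, FintypeCat.id_apply] at this
  exact this

/-- Triviality of the action of `σ ∈ Aut F` passes to quotients by finite groups.
[cite: SGA1, Exp. V §4] -/
theorem app_eq_id_of_isColimit_singleObj {G : Type*} [Monoid G] {K : SingleObj G ⥤ A}
    (c : Cocone K) (hc : IsColimit c) (σ : Aut F)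
    (h : σ.hom.app (K.obj (SingleObj.star G)) = 𝟙 _) :
    σ.hom.app c.pt = 𝟙 _ := by
  have := epi_ι_of_isColimit_singleObj c hc
  exact app_eq_id_of_surjective F _
    (surjective_on_fiber_of_epi F (c.ι.app (SingleObj.star G))) σ h

end Fibres

/-! ### The dictionary: domination by a `Σ`-Galois object `↔` an open normal subgroup of
`Σ`-index acts trivially -/

section Dictionary

variable {A : Type u₁} [Category.{v₁} A] [GaloisCategory A]

/-- (⇒) If `X` is dominated by a Galois object `Y` with `Σ`-automorphism group, then the open
normal subgroup `N_Y = Stab(a) ≤ Aut F` (`a ∈ F(Y)`; normal because `Y` is Galois, of index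
`|F(Y)| = |Aut Y|`) acts trivially on `F(X)`. [cite: MochizukiSemiAnbd2006, Def. 2.9(ii) p.31] -/
theorem exists_openNormal_of_proSigmaObj (F : A ⥤ FintypeCat.{w}) [FiberFunctor F]
    {Sigma : Set ℕ} {X : A} (hX : proSigmaObj Sigma X) :
    ∃ U : OpenSubgroup (Aut F), U.toSubgroup.Normal ∧
      IsSigmaInteger Sigma U.toSubgroup.index ∧ ∀ σ ∈ U, σ.hom.app X = 𝟙 _ := by
  obtain ⟨Y, hY, hSig, n, f, hf⟩ := hX
  obtain ⟨a⟩ := nonempty_fiber_of_isConnected F Y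
  refine ⟨⟨MulAction.stabilizer (Aut F) a, stabilizer_isOpen (Aut F) a⟩,
    stabilizer_normal_of_isGalois F Y a, ?_, fun σ hσ => ?_⟩
  · change IsSigmaInteger Sigma (MulAction.stabilizer (Aut F) a).index
    rw [MulAction.index_stabilizer_of_transitive,
      Nat.card_congr (evaluationEquivOfIsGalois F Y a).symm]
    exact hSig
  · -- `σ` acts trivially on the fibre of `Y` (normality of the stabiliser + transitivity)
    have hYtriv : σ.hom.app Y = 𝟙 _ := by
      ext y
      obtain ⟨τ, rfl⟩ := MulAction.exists_smul_eq (Aut F) a y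
      have hmem : τ⁻¹ * σ * τ ∈ MulAction.stabilizer (Aut F) a := by
        simpa using (stabilizer_normal_of_isGalois F Y a).conj_mem σ hσ τ⁻¹
      change σ • τ • a = τ • a
      rw [smul_smul, show σ * τ = τ * (τ⁻¹ * σ * τ) by
          simp only [← mul_assoc, mul_inv_cancel, one_mul],
        ← smul_smul, MulAction.mem_stabilizer_iff.mp hmem]
    -- hence on the fibre of `∐ Y`, and on the fibre of its quotient `X`
    have hcop : σ.hom.app (∐ fun _ : Fin n => Y) = 𝟙 _ :=
      app_eq_id_of_isColimit F _ (coproductIsCoproduct fun _ : Fin n => Y) σ (fun _ => hYtriv)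
    exact app_eq_id_of_surjective F f (surjective_on_fiber_of_epi F f) σ hcop

/-- (⇐) If an open normal subgroup `U ≤ Aut F` of `Σ`-index acts trivially on `F(X)`, then `X`
is dominated by a Galois object with `Σ`-automorphism group: the object `Y` with
`F(Y) ≅ Aut F ⧸ U` (Mathlib `exists_lift_of_quotient_openSubgroup`) is Galois with
`|Aut Y| = [Aut F : U]`, and the `U`-invariant points of `F(X)` — all of them — give maps
`Y ⟶ X` covering `F(X)`. [cite: MochizukiSemiAnbd2006, Def. 2.9(ii) p.31] -/
theorem proSigmaObj_of_openNormal (F : A ⥤ FintypeCat.{u₁}) [FiberFunctor F] {Sigma : Set ℕ}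
    {X : A} (U : OpenSubgroup (Aut F)) (hUn : U.toSubgroup.Normal)
    (hSig : IsSigmaInteger Sigma U.toSubgroup.index) (htriv : ∀ σ ∈ U, σ.hom.app X = 𝟙 _) :
    proSigmaObj Sigma X := by
  classical
  haveI : Finite (Aut F ⧸ U.toSubgroup) := U.toSubgroup.quotient_finite_of_isOpen U.isOpen'
  letI : Fintype (Aut F ⧸ U.toSubgroup) := Fintype.ofFinite _
  obtain ⟨Y, ⟨u⟩⟩ := exists_lift_of_quotient_openSubgroup (F := F) U
  -- the underlying isomorphism of finite sets `F(Y) ≅ Aut F ⧸ U` and its basic properties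
  let u' : F.obj Y ≅ FintypeCat.of (Aut F ⧸ U.toSubgroup) := (Action.forget _ _).mapIso u
  have hnat : ∀ (σ : Aut F) (y : F.obj Y), u'.hom (σ.hom.app Y y) = σ • u'.hom y :=
    fun σ y => ConcreteCategory.congr_hom (u.hom.comm σ) y
  have hinj : Function.Injective u'.hom := fun y₁ y₂ h => by
    simpa [FintypeCat.hom_inv_id_apply] using congrArg u'.inv h
  -- `Aut F` acts transitively on the fibre of `Y`
  have htrans : ∀ y₁ y₂ : F.obj Y, ∃ σ : Aut F, σ.hom.app Y y₁ = y₂ := by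
    intro y₁ y₂
    obtain ⟨g₁, hg₁⟩ := QuotientGroup.mk_surjective (u'.hom y₁)
    obtain ⟨g₂, hg₂⟩ := QuotientGroup.mk_surjective (u'.hom y₂)
    refine ⟨g₂ * g₁⁻¹, hinj ?_⟩
    rw [hnat, ← hg₁, ← hg₂, MulAction.Quotient.smul_mk, smul_eq_mul, inv_mul_cancel_right]
  -- base point
  let y₀ : F.obj Y := u'.inv ((1 : Aut F) : Aut F ⧸ U.toSubgroup)
  have hy₀ : u'.hom y₀ = ((1 : Aut F) : Aut F ⧸ U.toSubgroup) :=
    FintypeCat.inv_hom_id_apply u' _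
  -- `Y` is connected
  haveI : IsConnected Y := by
    refine ⟨fun hi => not_initial_of_inhabited F y₀ hi, fun Z i _ hZ => ?_⟩
    obtain ⟨z₀⟩ := (not_initial_iff_fiber_nonempty F Z).mp hZ
    have hiinj : Function.Injective (F.map i) :=
      ConcreteCategory.injective_of_mono_of_preservesPullback (F.map i)
    have hisurj : Function.Surjective (F.map i) := fun y => by
      obtain ⟨σ, hσ⟩ := htrans (F.map i z₀) y
      exact ⟨σ.hom.app Z z₀, by
        rw [← hσ]; exact (NatTrans.naturality_apply σ.hom i z₀).symm⟩
    exact isIso_of_mono_of_eq_card_fiber F i (Nat.card_eq_of_bijective _ ⟨hiinj, hisurj⟩)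
  -- `Y` is Galois: `Aut Y` acts transitively on `F(Y)`, because right multiplications on
  -- `Aut F ⧸ U` (normal `U`) are `Aut F`-automorphisms and lift along the fully faithful `H`
  haveI : IsGalois Y := by
    rw [isGalois_iff_pretransitive F Y]
    refine ⟨fun y₁ y₂ => ?_⟩
    obtain ⟨g₁, hg₁⟩ := QuotientGroup.mk_surjective (u'.hom y₁)
    obtain ⟨g₂, hg₂⟩ := QuotientGroup.mk_surjective (u'.hom y₂)
    let a : Aut F := g₂⁻¹ * g₁
    let eIso : (Aut F ⧸ₐ U.toSubgroup) ≅ (Aut F ⧸ₐ U.toSubgroup) :=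
      { hom := Action.FintypeCat.toEndHom U.toSubgroup a
        inv := Action.FintypeCat.toEndHom U.toSubgroup a⁻¹
        hom_inv_id := by
          rw [← End.mul_def, ← map_mul, inv_mul_cancel, map_one, End.one_def]
        inv_hom_id := by
          rw [← End.mul_def, ← map_mul, mul_inv_cancel, map_one, End.one_def] }
    let φ : Y ≅ Y := (functorToAction F).preimageIso (u ≪≫ eIso ≪≫ u.symm)
    refine ⟨φ, ?_⟩
    have hφ : (functorToAction F).map φ.hom = (u ≪≫ eIso ≪≫ u.symm).hom :=
      (functorToAction F).map_preimage _
    have hφ' : F.map φ.hom = u.hom.hom ≫ eIso.hom.hom ≫ u.inv.hom := by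
      have := congrArg Action.Hom.hom hφ
      simp only [Iso.trans_hom, Iso.symm_hom, Action.comp_hom, functorToAction_map] at this
      exact this
    have ha : g₁ * a⁻¹ = g₂ := by
      simp only [a, mul_inv_rev, inv_inv, mul_inv_cancel_left]
    change F.map φ.hom y₁ = y₂
    rw [hφ']
    apply hinj
    change u'.hom (u'.inv (eIso.hom.hom (u'.hom y₁))) = u'.hom y₂
    rw [FintypeCat.inv_hom_id_apply, ← hg₁, ← hg₂, ← ha]
    rfl
  -- `|Aut Y| = [Aut F : U]`
  have hcard : Nat.card (Aut Y) = U.toSubgroup.index := by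
    rw [Nat.card_congr (evaluationEquivOfIsGalois F Y y₀), Subgroup.index]
    exact Nat.card_congr (FintypeCat.incl.mapIso u').toEquiv
  -- through every point of `F(X)` passes a map `Y ⟶ X` (here the `U`-triviality of `X` enters)
  have hψ : ∀ x : F.obj X, ∃ ψ : Y ⟶ X, F.map ψ y₀ = x := by
    intro x
    have hwd : ∀ g₁ g₂ : Aut F, (g₁ : Aut F ⧸ U.toSubgroup) = g₂ →
        g₁.hom.app X x = g₂.hom.app X x := by
      intro g₁ g₂ h
      have h1 : (g₁⁻¹ * g₂).hom.app X = 𝟙 _ := htriv _ (QuotientGroup.eq.mp h)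
      calc g₁.hom.app X x = g₁.hom.app X ((g₁⁻¹ * g₂).hom.app X x) := by rw [h1]; rfl
        _ = (g₁ * (g₁⁻¹ * g₂)).hom.app X x := rfl
        _ = g₂.hom.app X x := by rw [mul_inv_cancel_left]
    let q : (Aut F ⧸ₐ U.toSubgroup) ⟶ (functorToAction F).obj X :=
      { hom := FintypeCat.homMk (Quotient.lift (fun g : Aut F => g.hom.app X x)
          (fun g₁ g₂ h => hwd g₁ g₂ (Quotient.sound h)))
        comm := fun σ => by
          ext q
          induction q using Quotient.inductionOn with
          | h g => rfl }
    refine ⟨(functorToAction F).preimage (u.hom ≫ q), ?_⟩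
    have hmap : F.map ((functorToAction F).preimage (u.hom ≫ q)) = u.hom.hom ≫ q.hom := by
      have := congrArg Action.Hom.hom ((functorToAction F).map_preimage (u.hom ≫ q))
      simp only [Action.comp_hom, functorToAction_map] at this
      exact this
    rw [hmap]
    change q.hom (u'.hom y₀) = x
    rw [hy₀]
    rfl
  choose ψ hψ using hψ
  obtain ⟨n, ⟨e⟩⟩ := Finite.exists_equiv_fin (F.obj X)
  let f : (∐ fun _ : Fin n => Y) ⟶ X := Limits.Sigma.desc fun i => ψ (e.symm i)
  have hf : Function.Surjective (F.map f) := fun x =>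
    ⟨F.map (Limits.Sigma.ι (fun _ : Fin n => Y) (e x)) y₀, by
      rw [← FintypeCat.comp_apply, ← F.map_comp, Limits.Sigma.ι_desc, hψ,
        Equiv.symm_apply_apply]⟩
  have hepi : Epi (F.map f) := ConcreteCategory.epi_of_surjective _ hf
  refine ⟨Y, inferInstance, ?_, n, f, F.epi_of_epi_map hepi⟩
  rw [hcard]
  exact hSig

/-- Open normal subgroups of `Σ`-index are stable under finite intersections (with `⊤` as the
empty intersection). [cite: MochizukiSemiAnbd2006, Def. 2.9(i) p.31] -/
theorem exists_openNormal_le_finset {G : Type*} [Group G] [TopologicalSpace G]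
    {Sigma : Set ℕ} {ι : Type*} (U : ι → OpenSubgroup G) (hn : ∀ i, (U i).toSubgroup.Normal)
    (hS : ∀ i, IsSigmaInteger Sigma (U i).toSubgroup.index) (s : Finset ι) :
    ∃ V : OpenSubgroup G, V.toSubgroup.Normal ∧ IsSigmaInteger Sigma V.toSubgroup.index ∧
      ∀ i ∈ s, V ≤ U i := by
  classical
  induction s using Finset.induction_on with
  | empty =>
    refine ⟨⊤, ?_, ?_, by simp⟩
    · change (⊤ : Subgroup G).Normal
      infer_instance
    · change IsSigmaInteger Sigma (⊤ : Subgroup G).index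
      rw [Subgroup.index_top]
      exact IsSigmaInteger.one Sigma
  | insert i s hi ih =>
    obtain ⟨V, hVn, hVS, hV⟩ := ih
    haveI := hn i
    refine ⟨U i ⊓ V, ?_, ?_, fun j hj => ?_⟩
    · change ((U i).toSubgroup ⊓ V.toSubgroup).Normal
      infer_instance
    · change IsSigmaInteger Sigma ((U i).toSubgroup ⊓ V.toSubgroup).index
      exact IsSigmaInteger.index_inf (hS i) hVS
    · rcases Finset.mem_insert.mp hj with rfl | hj
      · exact inf_le_left
      · exact inf_le_right.trans (hV j hj)

end Dictionary

/-! ### The theorem -/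

section Main

/-- **[SemiAnbd] Definition 2.9 (ii), the implicit claim: the pro-`Σ` completion of a connected
anabelioid is a connected anabelioid** — discharge of the named fact
`proSigmaCompletion_galoisCategory`: for a Galois category `A` and a set of primes `Σ`, the full
subcategory of objects dominated by a Galois object with `Σ`-automorphism group is a Galois
category. [cite: MochizukiSemiAnbd2006, Def. 2.9(ii) p.31] -/
theorem proSigmaCompletion_galoisCategory_holds :
    proSigmaCompletion_galoisCategory.{v₁, u₁} := by
  intro A _ _ Sigma
  classical
  let F : A ⥤ FintypeCat.{u₁} :=
    GaloisCategory.getFiberFunctor A ⋙ FintypeCat.uSwitch.{v₁, u₁}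
  haveI : FiberFunctor F := FiberFunctor.comp_right _
  -- the dictionary
  have key : ∀ X : A, proSigmaObj Sigma X ↔ ∃ U : OpenSubgroup (Aut F),
      U.toSubgroup.Normal ∧ IsSigmaInteger Sigma U.toSubgroup.index ∧
        ∀ σ ∈ U, σ.hom.app X = 𝟙 _ :=
    fun X => ⟨exists_openNormal_of_proSigmaObj F,
      fun ⟨U, hUn, hSig, htriv⟩ => proSigmaObj_of_openNormal F U hUn hSig htriv⟩
  -- a common open normal subgroup of `Σ`-index for a finite family of objects of the completion
  have common : ∀ {ι : Type} [Finite ι] (X : ι → A), (∀ i, proSigmaObj Sigma (X i)) →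
      ∃ V : OpenSubgroup (Aut F), V.toSubgroup.Normal ∧
        IsSigmaInteger Sigma V.toSubgroup.index ∧
          ∀ i, ∀ σ ∈ V, σ.hom.app (X i) = 𝟙 _ := by
    intro ι _ X hX
    haveI := Fintype.ofFinite ι
    choose U hUn hUS hUtriv using fun i => (key (X i)).mp (hX i)
    obtain ⟨V, hVn, hVS, hV⟩ := exists_openNormal_le_finset U hUn hUS Finset.univ
    exact ⟨V, hVn, hVS, fun i σ hσ => hUtriv i σ (hV i (Finset.mem_univ i) hσ)⟩
  -- stability under subobjects
  have hm : ∀ ⦃X Y : A⦄ (i : X ⟶ Y) [Mono i],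
      proSigmaObj Sigma Y → proSigmaObj Sigma X := by
    intro X Y i _ hY
    obtain ⟨U, hUn, hSig, htriv⟩ := (key Y).mp hY
    exact (key X).mpr ⟨U, hUn, hSig, fun σ hσ => app_eq_id_of_injective F i
      (ConcreteCategory.injective_of_mono_of_preservesPullback (F.map i)) σ (htriv σ hσ)⟩
  -- stability under finite limits (terminal object, pullbacks)
  have hlim : ∀ (J : Type) [SmallCategory J] [FinCategory J],
      (proSigmaObj (A := A) Sigma).IsClosedUnderLimitsOfShape J := by
    intro J _ _
    refine ⟨fun X hX => ?_⟩
    obtain ⟨p⟩ := hX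
    obtain ⟨V, hVn, hVS, hV⟩ := common (fun j : J => p.diag.obj j) p.prop_diag_obj
    exact (key X).mpr ⟨V, hVn, hVS, fun σ hσ =>
      app_eq_id_of_isLimit F (Cone.mk X p.π) p.isLimit σ (fun j => hV j σ hσ)⟩
  -- stability under finite coproducts
  have hcopr : ∀ (J : Type) [Finite J],
      (proSigmaObj (A := A) Sigma).IsClosedUnderColimitsOfShape (Discrete J) := by
    intro J _
    refine ⟨fun X hX => ?_⟩
    obtain ⟨p⟩ := hX
    obtain ⟨V, hVn, hVS, hV⟩ :=
      common (fun j : J => p.diag.obj ⟨j⟩) (fun j => p.prop_diag_obj _)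
    exact (key X).mpr ⟨V, hVn, hVS, fun σ hσ =>
      app_eq_id_of_isColimit F (Cocone.mk X p.ι) p.isColimit σ (fun j => hV j.as σ hσ)⟩
  -- stability under quotients by finite groups
  have hquot : ∀ (G : Type v₁) [Group G] [Finite G],
      (proSigmaObj (A := A) Sigma).IsClosedUnderColimitsOfShape (SingleObj G) := by
    intro G _ _
    refine ⟨fun X hX => ?_⟩
    obtain ⟨p⟩ := hX
    obtain ⟨U, hUn, hSig, htriv⟩ := (key _).mp (p.prop_diag_obj (SingleObj.star G))
    exact (key X).mpr ⟨U, hUn, hSig, fun σ hσ =>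
      app_eq_id_of_isColimit_singleObj F (Cocone.mk X p.ι) p.isColimit σ (htriv σ hσ)⟩
  haveI := hlim (Discrete PEmpty.{1})
  haveI := hlim WalkingCospan
  exact galoisCategory_fullSubcategory (P := proSigmaObj (A := A) Sigma) hcopr hquot hm

end Main

end Literature.AnabelianGeometry.Anabelioids
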